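import Literature.AlgebraicTopology.SingularHomology.CechCohomology
import Literature.AlgebraicTopology.SingularHomology.SubsetCohomologyContractible
import Literature.AlgebraicTopology.Homotopy.ENRTheorem
import Mathlib.Analysis.Normed.Module.Convex
import HarnessLib

/-!
# Tautness: the Čech cohomology of a neighbourhood retract is its singular cohomology

E. H. Spanier, *Algebraic Topology* (1966), Ch. 6 §1: the natural map `H̄^q(A) = lim_→ H^q(U) → H^q(A)`
(p. 289) is an isomorphism when `A` is *taut*; Thm. 6.1.10 / Cor. 6.1.11: a neighbourhood retract
of a space in which it has arbitrarily small neighbourhoods deformable onto it is taut — in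
particular (Ex. 6.1.7, and A. Hatcher, *Algebraic Topology* (2002), Appendix, Cor. A.9 with
Thm. A.7) a compact Euclidean neighbourhood retract `K` inside a Euclidean neighbourhood retract
`X`; H. Miller, *Lectures on Algebraic Topology* (2020), Lemma 34.5 and p. 121 ("with `K = M`,
`Ȟ^p(M) = H^p(M)`").  The printed argument: a retraction `r : U₀ → K` gives classes on `U₀`
restricting to prescribed classes on `K` (surjectivity), and if every neighbourhood `U ⊆ U₀`
contains a neighbourhood `V` on which the inclusion `V ↪ U` is homotopic to `V →ʳ K ↪ U`, a
class dying on `K` already dies on `V` (injectivity), by homotopy invariance of singular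
cohomology.

For the tree's Čech cohomology `Cech R N K p = lim_→ H^p_X(U; N)` over the open neighbourhoods
of `K ⊆ X` (`CechCohomology.lean`; cohomology of subsets computed in `C(X)`,
`SubsetCochains.lean`) this file PROVES:

* `dualSingularCohomology R N Y p = H^p(Hom_R(C_•(Y; R), N))` — the cohomology of a space on the
  `Hom`-dual of Mathlib's singular chain complex, with its pull-backs `map`, functoriality and
  **homotopy invariance** (`map_eq_of_homotopic`, dualising Mathlib's chain homotopy);
* `subsetCochains.isoDual`, `homologyIsoDual` — `H^p_X(A; N) ≅ H^p(Hom(C_•(↥A), N))` (duals of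
  the tree's `subspaceIso` and `csingularChainComplex.compIso`), and its **naturality**
  `resH_comp_homologyIsoDual_hom` under restriction along `A ⊆ B` versus the pull-back along
  the inclusion `↥A → ↥B`;
* `Cech.toSubset`, `Cech.toSingularCohomology` — the natural maps `Ȟ^p(K; N) → H^p_X(K; N)` and
  `Ȟ^p(K; ULift R) → H^p(↥K; R)` (the latter through `homologyIsoSingularCohomology` of
  `SubsetCohomologyContractible.lean`);
* `Cech.RetractionNhds K` — the tautness datum (an open `U₀ ⊇ K`, a retraction `r : U₀ → K`,
  and inside every open `K ⊆ U ⊆ U₀` an open `K ⊆ V ⊆ U` with `V ↪ U` homotopic to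
  `V →ʳ K ↪ U`), and **`Cech.RetractionNhds.bijective_toSubset`**: then `Ȟ^p(K; N) → H^p_X(K; N)`
  is bijective for every `N` (Spanier Thm. 6.1.10), whence the linear equivalence
  `Cech.RetractionNhds.cechEquiv : Ȟ^p(K; ULift R) ≃ₗ[R] H^p(↥K; R)`;
* `Cech.RetractionNhds.nonempty_of_isNeighbourhoodRetract` — the datum for `K ⊆ X` when `X`
  embeds in `ℝᵐ` with image a neighbourhood retract and the image of `K` is a neighbourhood
  retract (the straight-line homotopy pushed back into `X` by the ambient retraction; Spanier
  Cor. 6.1.11 / Hatcher p. 527), and `Cech.RetractionNhds.nonempty_of_locallyContractibleSpace` —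
  the same for `K` compact with `↥K` locally contractible, by the tree's PROVED
  Euclidean-neighbourhood-retract theorem
  (`isNeighbourhoodRetract_of_isCompact_of_locallyContractibleSpace`, Hatcher Thm. A.7);
  packaged as `Cech.bijective_toSubset_of_locallyContractibleSpace` and
  `Cech.cechEquivOfLocallyContractibleSpace`.

Everything is proved; no named facts. Consumers: the Euler-characteristic count of a closed
cover of a compact manifold by compact submanifolds (`Literature/Topology/FourManifolds/`).

## References

* E. H. Spanier, *Algebraic Topology*, Springer 1981, Ch. 6 §1, p. 289, Thm. 10, Cor. 11,
  Ex. 7. [Spanier1981]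
* A. Hatcher, *Algebraic Topology*, CUP 2002, §3.1 p. 201; Appendix, Thm. A.7, Cor. A.9,
  p. 527. [HatcherAT2002]
* H. Miller, *Lectures on Algebraic Topology*, World Scientific 2020, Lemma 34.5, p. 121.
  [Miller2020]
-/

noncomputable section

open CategoryTheory Limits Set
open _root_.Topology

universe u v

namespace Literature.AlgebraicTopology.SingularHomology

/-! ### Cohomology through the dual of Mathlib's singular chain complex -/

section Dual

variable (R : Type v) [CommRing R] (N : ModuleCat.{max u v} R)
variable {Y Y' Y'' : Type u} [TopologicalSpace Y] [TopologicalSpace Y'] [TopologicalSpace Y'']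

variable (Y) in
/-- `H^p(Hom_R(C_•(Y; R), N))`: the cohomology of `Y` with coefficients in `N` computed on the
`Hom`-dual (`dualObj`, `HomDualComplex.lean`) of Mathlib's singular chain complex — the
complex to which both the cochains computed in an ambient space (`subsetCochains`) and the
function cochains `singularCochainComplex` are compared (Hatcher 2002, §3.1, p. 197: "the
singular cochain complex is the dual of the singular chain complex"). [cite: HatcherAT2002, §3.1 p. 197] -/
abbrev dualSingularCohomology (p : ℕ) : ModuleCat.{max u v} R :=
  (dualObj R N (singularChainComplex R R Y)).homology p

namespace dualSingularCohomology

/-- The pull-back `f* : H^p(Y'; N) → H^p(Y; N)` along a continuous map, the map induced by the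
dual of `f♯` (Hatcher 2002, §3.1, p. 197). [cite: HatcherAT2002, §3.1 p. 197] -/
abbrev map (f : C(Y, Y')) (p : ℕ) :
    dualSingularCohomology R N Y' p ⟶ dualSingularCohomology R N Y p :=
  HomologicalComplex.homologyMap (dualMap R N (singularChainComplex.map R R f)) p

variable {R N}

/-- `𝟙* = 𝟙`. [folklore] -/
@[simp] theorem map_id (p : ℕ) : map R N (ContinuousMap.id Y) p = 𝟙 _ := by
  rw [map, singularChainComplex.map_id, dualMap_id, HomologicalComplex.homologyMap_id]

/-- `(g ∘ f)* = g* ∘ f*`, i.e. `map (g ∘ f) = map g ≫ map f`. [folklore] -/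
theorem map_comp (f : C(Y, Y')) (g : C(Y', Y'')) (p : ℕ) :
    map R N (g.comp f) p = map R N g p ≫ map R N f p := by
  rw [map, map, map, singularChainComplex.map_comp, dualMap_comp,
    HomologicalComplex.homologyMap_comp]

/-- **Homotopy invariance** (Hatcher 2002, §3.1, p. 201: "`g♯ - f♯ = ∂P + P∂` dualizes to
`g♯ - f♯ = P*δ + δP*`"): homotopic maps induce the same map, by dualising Mathlib's chain
homotopy `TopCat.Homotopy.singularChainComplexFunctorObjMap` (`dualHomotopy`).
[cite: HatcherAT2002, §3.1 p. 201] -/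
theorem map_eq_of_homotopic {f g : C(Y, Y')} (h : f.Homotopic g) (p : ℕ) :
    map R N f p = map R N g p :=
  (dualHomotopy (N := N)
    (TopCat.Homotopy.singularChainComplexFunctorObjMap (f := TopCat.ofHom f) (g := TopCat.ofHom g)
      h.some (ModuleCat.of R (ULift.{u} R)))).homologyMap_eq p

end dualSingularCohomology

end Dual

/-! ### `H^p_X(A; N) ≅ H^p(Hom(C_•(↥A), N))`, naturally in `A` -/

namespace subsetCochains

variable (R : Type v) [CommRing R] (N : ModuleCat.{max u v} R) {X : Type u} [TopologicalSpace X]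

/-- **Naturality of `C(↥A) ≅ C_X(A)` under `A ⊆ B`**: co-restricting the chains of `↥A` and then
including `C_X(A) ↪ C_X(B)` is pushing forward along `↥A → ↥B` and then co-restricting
(both are lifts of `C(↥A) → C(X)`, Hatcher 2002, §2.1). [folklore] -/
theorem subspaceIso_hom_comp_incl {A B : Set X} (h : A ⊆ B) :
    (subspaceIso R R X A).hom ≫ Subcomplex.incl (chainsInSub_mono R R h) =
      csingularChainComplex.map R R (ContinuousMap.inclusion h) ≫ (subspaceIso R R X B).hom := by
  rw [← cancel_mono (chainsInSub R R X B).ι, Category.assoc, Category.assoc, Subcomplex.incl_ι,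
    subspaceIso, subspaceIso, asIso_hom, asIso_hom, subspaceLift_ι, subspaceLift_ι,
    ← csingularChainComplex.map_comp]
  rfl

/-- **`Hom(C_X(A), N) ≅ Hom(C_•(↥A), N)`** (cochain level): the dual of `C(↥A) ≅ C_X(A)`
(`subspaceIso`) followed by the dual of the comparison of the concrete chains of `↥A` with
Mathlib's (`csingularChainComplex.compIso`) (Hatcher 2002, §3.1 p. 197 with §2.1).
[cite: HatcherAT2002, §3.1 p. 197] -/
def isoDual (A : Set X) : subsetCochains R N A ≅ dualObj R N (singularChainComplex R R (↥A)) :=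
  dualMapIso (N := N) (subspaceIso R R X A) ≪≫
    (dualMapIso (N := N) (csingularChainComplex.compIso R R (↥A))).symm

/-- **Naturality of `isoDual` under `A ⊆ B`**: restriction of cochains computed in `C(X)`
corresponds to the dual of the push-forward `C_•(↥A) → C_•(↥B)` along the inclusion
(Hatcher 2002, §3.1, p. 199, "`i*` restricts a cochain"). [cite: HatcherAT2002, §3.1 p. 199] -/
theorem res_comp_isoDual_hom {A B : Set X} (h : A ⊆ B) :
    res R N h ≫ (isoDual R N A).hom =
      (isoDual R N B).hom ≫ dualMap R N (singularChainComplex.map R R (ContinuousMap.inclusion h)) := by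
  have hc : csingularChainComplex.map R R (ContinuousMap.inclusion h) =
      (csingularChainComplex.compIso R R (↥A)).hom ≫
        singularChainComplex.map R R (ContinuousMap.inclusion h) ≫
          (csingularChainComplex.compIso R R (↥B)).inv := by
    rw [← Category.assoc, ← csingularChainComplex.map_comp_compIso_hom, Category.assoc,
      Iso.hom_inv_id, Category.comp_id]
  have key : (csingularChainComplex.compIso R R (↥A)).inv ≫ (subspaceIso R R X A).hom ≫
      Subcomplex.incl (chainsInSub_mono R R h) =
      singularChainComplex.map R R (ContinuousMap.inclusion h) ≫
        (csingularChainComplex.compIso R R (↥B)).inv ≫ (subspaceIso R R X B).hom := by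
    rw [subspaceIso_hom_comp_incl R h, hc]
    simp only [Category.assoc, Iso.inv_hom_id_assoc]
  change dualMap R N _ ≫ dualMap R N _ ≫ dualMap R N _ = (dualMap R N _ ≫ dualMap R N _) ≫ dualMap R N _
  rw [← dualMap_comp, ← dualMap_comp, ← dualMap_comp, ← dualMap_comp, Category.assoc, key]

/-- **`H^p_X(A; N) ≅ H^p(Hom(C_•(↥A), N))`**: the cohomology computed in `C(X)` is the cohomology of
the dual of the singular chains of the subspace (Hatcher 2002, §3.1 p. 197).
[cite: HatcherAT2002, §3.1 p. 197] -/
def homologyIsoDual (A : Set X) (p : ℕ) :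
    (subsetCochains R N A).homology p ≅ dualSingularCohomology R N (↥A) p :=
  (HomologicalComplex.homologyFunctor _ _ p).mapIso (isoDual R N A)

/-- **Naturality of `H^p_X(A; N) ≅ H^p(Hom(C_•(↥A), N))` under `A ⊆ B`**: restriction in the
cohomology computed in `C(X)` is the pull-back along the inclusion `↥A → ↥B`
(Hatcher 2002, §3.1, p. 199). [cite: HatcherAT2002, §3.1 p. 199] -/
theorem resH_comp_homologyIsoDual_hom {A B : Set X} (h : A ⊆ B) (p : ℕ) :
    resH h p ≫ (homologyIsoDual R N A p).hom =
      (homologyIsoDual R N B p).hom ≫ dualSingularCohomology.map R N (ContinuousMap.inclusion h) p := by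
  change HomologicalComplex.homologyMap _ p ≫ HomologicalComplex.homologyMap _ p =
    HomologicalComplex.homologyMap _ p ≫ HomologicalComplex.homologyMap _ p
  rw [← HomologicalComplex.homologyMap_comp, ← HomologicalComplex.homologyMap_comp,
    res_comp_isoDual_hom]

/-- Elementwise form of the naturality. [cite: HatcherAT2002, §3.1 p. 199] -/
theorem homologyIsoDual_hom_resH {A B : Set X} (h : A ⊆ B) (p : ℕ)
    (b : (subsetCochains R N B).homology p) :
    (homologyIsoDual R N A p).hom (resH h p b) =
      dualSingularCohomology.map R N (ContinuousMap.inclusion h) p ((homologyIsoDual R N B p).hom b) := by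
  rw [← ModuleCat.comp_apply, ← ModuleCat.comp_apply, resH_comp_homologyIsoDual_hom]

end subsetCochains

/-! ### The natural map `Ȟ^p(K) → H^p_X(K)` and tautness -/

namespace Cech

open subsetCochains

variable (R : Type v) [CommRing R] (N : ModuleCat.{max u v} R) {X : Type u} [TopologicalSpace X]

/-- **The natural map `Ȟ^p(K; N) → H^p_X(K; N)`**: restriction from each open neighbourhood to
`K` (Spanier 1966, Ch. 6 §1, p. 289, the map `H̄^q(A) → H^q(A)`; Miller 2020, before Lemma 34.5).
[cite: Spanier1981, Ch. 6 §1 p. 289] -/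
def toSubset (K : Set X) (p : ℕ) : Cech R N K p →ₗ[R] (subsetCochains R N K).homology p :=
  lift R N (fun U => (resH U.subset p).hom) fun U V hUV a => by
    change (resH hUV p ≫ resH V.subset p) a = resH U.subset p a
    rw [← HomologicalComplex.homologyMap_comp, ← res_comp]

variable {R N} in
/-- `toSubset` on a structure map is restriction to `K`. [cite: Spanier1981, Ch. 6 §1 p. 289] -/
@[simp] theorem toSubset_of {K : Set X} {p : ℕ} (U : OpenNhd X K) (a) :
    toSubset R N K p (of R N U a) = resH U.subset p a :=
  lift_of _ _ _ _

/-- **The natural map `Ȟ^p(K; ULift R) → H^p(↥K; R)`** to the singular cohomology of the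
subspace: `toSubset` followed by the comparison `H^p_X(K; ULift R) ≅ H^p(↥K; R)` of
`SubsetCohomologyContractible.lean` (Spanier 1966, Ch. 6 §1, p. 289). [cite: Spanier1981, Ch. 6 §1 p. 289] -/
def toSingularCohomology (K : Set X) (p : ℕ) :
    Cech R (ModuleCat.of R (ULift.{u} R)) K p →ₗ[R] singularCohomology R R (↥K) p :=
  (homologyIsoSingularCohomology R K p).hom.hom ∘ₗ toSubset R (ModuleCat.of R (ULift.{u} R)) K p

/-- **Tautness datum** (the hypothesis of Spanier 1966, Thm. 6.1.10 for a single subset): an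
open neighbourhood `U₀ ⊇ K`, a retraction `r : U₀ → K`, and inside every open `U` with
`K ⊆ U ⊆ U₀` an open `V` with `K ⊆ V ⊆ U` on which the inclusion `V ↪ U` is homotopic to
`V →ʳ K ↪ U`. [cite: Spanier1981, Ch. 6 §1, Thm. 10] -/
structure RetractionNhds (K : Set X) where
  /-- the retracting neighbourhood -/
  U₀ : Set X
  /-- it is open -/
  isOpen : IsOpen U₀
  /-- it contains `K` -/
  subset : K ⊆ U₀
  /-- the retraction `U₀ → K` -/
  r : C(U₀, K)
  /-- `r` fixes `K` pointwise -/
  retract : ∀ (x : X) (hx : x ∈ K), r ⟨x, subset hx⟩ = ⟨x, hx⟩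
  /-- small neighbourhoods deform into `K` inside any given neighbourhood -/
  homotopic : ∀ U : Set X, IsOpen U → K ⊆ U → ∀ hU : U ⊆ U₀,
    ∃ (V : Set X) (_ : IsOpen V) (hKV : K ⊆ V) (hVU : V ⊆ U),
      (ContinuousMap.inclusion hVU).Homotopic
        ((ContinuousMap.inclusion (hKV.trans hVU)).comp
          (r.comp (ContinuousMap.inclusion (hVU.trans hU))))

namespace RetractionNhds

variable {R N} {K : Set X}

/-- The retracting neighbourhood as an `OpenNhd`. [folklore] -/
def nhd₀ (T : RetractionNhds K) : OpenNhd X K := ⟨T.U₀, T.isOpen, T.subset⟩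

/-- `K ↪ U₀ →ʳ K` is the identity. [folklore] -/
theorem r_comp_inclusion (T : RetractionNhds K) : T.r.comp (ContinuousMap.inclusion T.subset) = ContinuousMap.id K := by
  ext ⟨x, hx⟩ : 1
  exact T.retract x hx

/-- **Tautness, injectivity** (Spanier 1966, proof of Thm. 6.1.10): a Čech class of `K` whose
restriction to `K` vanishes is zero — it is represented on some `U ⊆ U₀`, and its restriction to
the `V ⊆ U` of the datum factors, up to homotopy, through its (zero) restriction to `K`.
[cite: Spanier1981, Ch. 6 §1, Thm. 10] -/
theorem injective_toSubset (T : RetractionNhds K) (p : ℕ) :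
    Function.Injective (toSubset R N K p) := by
  rw [injective_iff_map_eq_zero]
  intro z hz
  obtain ⟨U, hU₀, a, rfl⟩ := exists_of_le T.nhd₀ z
  rw [toSubset_of] at hz
  obtain ⟨V, hVo, hKV, hVU, hhom⟩ := T.homotopic U.carrier U.isOpen U.subset hU₀
  -- the restriction of `a` to `V` vanishes
  let V' : OpenNhd X K := ⟨V, hVo, hKV⟩
  have hle : U ≤ V' := hVU
  suffices h : resH (N := N) hle p a = 0 by
    rw [← of_res hle, h, map_zero]
  -- compare in `H^p(Hom(C_•(↥V), N))`
  have hinj : Function.Injective (homologyIsoDual R N V p).hom :=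
    ((forget (ModuleCat R)).mapIso (homologyIsoDual R N V p)).toEquiv.injective
  refine hinj ?_
  rw [map_zero]
  change (homologyIsoDual R N V p).hom (resH (hVU : V ⊆ U.carrier) p a) = 0
  rw [homologyIsoDual_hom_resH, dualSingularCohomology.map_eq_of_homotopic hhom p,
    dualSingularCohomology.map_comp, ModuleCat.comp_apply,
    ← homologyIsoDual_hom_resH R N U.subset p a, hz, map_zero, map_zero]

/-- **Tautness, surjectivity** (Spanier 1966, proof of Thm. 6.1.10): every class of `H^p_X(K)`
is the restriction of a class on `U₀`, namely of its pull-back along the retraction `r`.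
[cite: Spanier1981, Ch. 6 §1, Thm. 10] -/
theorem surjective_toSubset (T : RetractionNhds K) (p : ℕ) :
    Function.Surjective (toSubset R N K p) := by
  intro b
  let β := (homologyIsoDual R N K p).hom b
  let α := dualSingularCohomology.map R N T.r p β
  let a := (homologyIsoDual R N T.U₀ p).inv α
  refine ⟨of R N T.nhd₀ a, ?_⟩
  rw [toSubset_of]
  have hinj : Function.Injective (homologyIsoDual R N K p).hom :=
    ((forget (ModuleCat R)).mapIso (homologyIsoDual R N K p)).toEquiv.injective
  refine hinj ?_
  change (homologyIsoDual R N K p).hom (resH T.subset p a) = β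
  rw [homologyIsoDual_hom_resH]
  change dualSingularCohomology.map R N _ p (((homologyIsoDual R N T.U₀ p).inv ≫
    (homologyIsoDual R N T.U₀ p).hom) α) = β
  rw [Iso.inv_hom_id, ModuleCat.id_apply]
  change (dualSingularCohomology.map R N T.r p ≫
    dualSingularCohomology.map R N (ContinuousMap.inclusion T.subset) p) β = β
  rw [← dualSingularCohomology.map_comp, r_comp_inclusion, dualSingularCohomology.map_id,
    ModuleCat.id_apply]

/-- **Tautness** (Spanier 1966, Ch. 6 §1, Thm. 10; Miller 2020, Lemma 34.5): with a tautness
datum, `Ȟ^p(K; ULift R) → H^p_X(K; ULift R)` is bijective. [cite: Spanier1981, Ch. 6 §1, Thm. 10] -/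
theorem bijective_toSubset (T : RetractionNhds K) (p : ℕ) :
    Function.Bijective (toSubset R N K p) :=
  ⟨T.injective_toSubset p, T.surjective_toSubset p⟩

/-- **`Ȟ^p(K; ULift R) → H^p(↥K; R)` is bijective** for a subset with a tautness datum (Spanier
1966, Thm. 6.1.10 with `H^p_X(K) ≅ H^p(↥K)`). [cite: Spanier1981, Ch. 6 §1, Thm. 10] -/
theorem bijective_toSingularCohomology (T : RetractionNhds K) (p : ℕ) :
    Function.Bijective (toSingularCohomology R K p) :=
  ((forget (ModuleCat R)).mapIso (homologyIsoSingularCohomology R K p)).toEquiv.bijective.comp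
    (T.bijective_toSubset p)

variable (R) in
/-- **`Ȟ^p(K; ULift R) ≃ H^p(↥K; R)`** as a linear equivalence, for a subset with a tautness
datum (Spanier 1966, Thm. 6.1.10). [cite: Spanier1981, Ch. 6 §1, Thm. 10] -/
def cechEquiv (T : RetractionNhds K) (p : ℕ) :
    Cech R (ModuleCat.of R (ULift.{u} R)) K p ≃ₗ[R] singularCohomology R R (↥K) p :=
  LinearEquiv.ofBijective (toSingularCohomology R K p) (T.bijective_toSingularCohomology p)

end RetractionNhds

/-! ### Tautness data from Euclidean neighbourhood retractions -/

namespace RetractionNhds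

open Literature.AlgebraicTopology.Homotopy Metric unitInterval

variable {K : Set X} {m : ℕ} {ι : X → (Fin m → ℝ)}

/-- **A neighbourhood retract of a Euclidean neighbourhood retract is taut** (Spanier 1966,
Ch. 6 §1, Cor. 11 / Ex. 7; Hatcher 2002, p. 527): if `X` embeds in `ℝᵐ` by `ι` with `ι(X)` a
neighbourhood retract (retraction `ρ`) and `ι(K)` is a neighbourhood retract (retraction `r_K`),
then `K ⊆ X` carries a tautness datum: `U₀ = ι⁻¹(dom r_K)`, `r = ι⁻¹ ∘ r_K ∘ ι`, and, inside a
given neighbourhood `U`, the neighbourhood `V` of points `x` near which the straight segment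
from `ι x` to `r_K(ι x)` stays in the open set where `ρ` is defined with values in `ι(U)` — the
homotopy being `(t, x) ↦ ι⁻¹ ρ((1 - t) ι x + t r_K(ι x))`. [cite: Spanier1981, Ch. 6 §1, Cor. 11] -/
theorem nonempty_of_isNeighbourhoodRetract (hι : IsEmbedding ι)
    (hX : IsNeighbourhoodRetract (range ι)) (hK : IsNeighbourhoodRetract (ι '' K)) :
    Nonempty (RetractionNhds K) := by
  classical
  obtain ⟨OX, hOXo, hXO, ρ, hρ⟩ := hX.exists_retraction
  obtain ⟨OK, hOKo, hKO, rK, hrK⟩ := hK.exists_retraction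
  set e : X ≃ₜ range ι := hι.toHomeomorph with he
  have hesymm : ∀ (x : X) (hx : ι x ∈ range ι), e.symm ⟨ι x, hx⟩ = x := fun x hx =>
    hι.toHomeomorph_symm_apply x
  have heval : ∀ z : range ι, ι (e.symm z) = z := fun z => by
    obtain ⟨_, x, rfl⟩ := z
    rw [hesymm]
  -- the retracting neighbourhood `U₀ = ι⁻¹(OK)` and the retraction `r = ι⁻¹ ∘ r_K ∘ ι`
  have hU₀o : IsOpen (ι ⁻¹' OK) := hOKo.preimage hι.continuous
  have hKU₀ : K ⊆ ι ⁻¹' OK := fun x hx => hKO (mem_image_of_mem ι hx)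
  have hrK_range : ∀ y : OK, (rK y : Fin m → ℝ) ∈ range ι := fun y =>
    image_subset_range _ _ (rK y).2
  have hback : ∀ y : OK, e.symm ⟨(rK y : Fin m → ℝ), hrK_range y⟩ ∈ K := by
    intro y
    obtain ⟨k, hk, hky⟩ := (rK y).2
    have h1 : (⟨(rK y : Fin m → ℝ), hrK_range y⟩ : range ι) = ⟨ι k, mem_range_self k⟩ :=
      Subtype.ext hky.symm
    rw [h1, hesymm]
    exact hk
  let r : C(↥(ι ⁻¹' OK), ↥K) :=
    ⟨fun x => ⟨e.symm ⟨(rK ⟨ι x.1, x.2⟩ : Fin m → ℝ), hrK_range _⟩, hback _⟩,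
      (e.symm.continuous.comp ((continuous_subtype_val.comp (rK.continuous.comp
        ((hι.continuous.comp continuous_subtype_val).subtype_mk _))).subtype_mk _)).subtype_mk _⟩
  have hr : ∀ x : ↥(ι ⁻¹' OK),
      (r x : X) = e.symm ⟨(rK ⟨ι x.1, x.2⟩ : Fin m → ℝ), hrK_range _⟩ := fun x => rfl
  refine ⟨⟨ι ⁻¹' OK, hU₀o, hKU₀, r, fun x hx => ?_, fun U hUo hKU hUU₀ => ?_⟩⟩
  · -- `r` fixes `K`
    ext
    rw [hr]
    have h1 : rK ⟨ι x, hKU₀ hx⟩ = ⟨ι x, mem_image_of_mem ι hx⟩ := hrK (ι x) (mem_image_of_mem ι hx)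
    simp only [h1]
    exact hesymm x _
  · -- the small neighbourhood `V` and the homotopy
    obtain ⟨O', hO'o, hO'U⟩ := hι.isInducing.isOpen_iff.1 hUo
    -- `A`: the points of `OX` retracted by `ρ` into `ι(U)`
    let A : Set (Fin m → ℝ) := Subtype.val '' ((fun y : OX => (ρ y : Fin m → ℝ)) ⁻¹' O')
    have hAo : IsOpen A := hOXo.isOpenMap_subtype_val _
      (hO'o.preimage (continuous_subtype_val.comp ρ.continuous))
    have hAOX : A ⊆ OX := by
      rintro _ ⟨y, -, rfl⟩; exact y.2
    have hAU : ∀ (y : Fin m → ℝ) (hy : y ∈ A), e.symm (ρ ⟨y, hAOX hy⟩) ∈ U := by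
      rintro _ ⟨y, hy, rfl⟩
      rw [← hO'U, mem_preimage, heval]
      exact hy
    have hKA : ∀ k ∈ K, ι k ∈ A := fun k hk =>
      ⟨⟨ι k, hXO (mem_range_self k)⟩, by
        have hkU : k ∈ ι ⁻¹' O' := by rw [hO'U]; exact hKU hk
        change (ρ ⟨ι k, _⟩ : Fin m → ℝ) ∈ O'
        rw [hρ (ι k) (mem_range_self k)]
        exact hkU, rfl⟩
    -- radii: `ε` with `ball q ε ⊆ A ∩ OK`, `δ ≤ ε` a modulus of continuity of `r_K` at `q`
    have hrad : ∀ q ∈ ι '' K, ∃ ε > (0 : ℝ), ∃ δ > (0 : ℝ), δ ≤ ε ∧ ball q ε ⊆ A ∩ OK ∧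
        ∀ (y : Fin m → ℝ) (hy : y ∈ OK), dist y q < δ → dist (rK ⟨y, hy⟩ : Fin m → ℝ) q < ε := by
      intro q hq
      obtain ⟨k, hk, rfl⟩ := hq
      obtain ⟨ε, hε, hball⟩ := Metric.isOpen_iff.1 (hAo.inter hOKo) (ι k)
        ⟨hKA k hk, hKO (mem_image_of_mem ι hk)⟩
      have hcont := Metric.continuousAt_iff.1 (rK.continuous.continuousAt
        (x := ⟨ι k, hKO (mem_image_of_mem ι hk)⟩)) ε hε
      obtain ⟨δ, hδ, hδε⟩ := hcont
      refine ⟨ε, hε, min δ ε, lt_min hδ hε, min_le_right _ _, hball, fun y hy hyq => ?_⟩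
      have h1 := hδε (x := ⟨y, hy⟩) (lt_of_lt_of_le hyq (min_le_left _ _))
      rwa [hrK (ι k) (mem_image_of_mem ι hk), Subtype.dist_eq] at h1
    choose! ε hε δ hδ hδε hball hcont using hrad
    -- `V = ι⁻¹(⋃_{q ∈ ι K} ball q (δ q))`
    let VE : Set (Fin m → ℝ) := ⋃ q ∈ ι '' K, ball q (δ q)
    have hVEo : IsOpen VE := isOpen_biUnion fun q _ => isOpen_ball
    let V : Set X := ι ⁻¹' VE
    have hVo : IsOpen V := hVEo.preimage hι.continuous
    have hKV : K ⊆ V := fun k hk =>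
      mem_biUnion (mem_image_of_mem ι hk) (mem_ball_self (hδ _ (mem_image_of_mem ι hk)))
    have hVOK : V ⊆ ι ⁻¹' OK := fun x hx => by
      obtain ⟨q, hq, hxq⟩ := mem_iUnion₂.1 hx
      exact (hball q hq (mem_ball.2 (lt_of_lt_of_le (mem_ball.1 hxq) (hδε q hq)))).2
    -- the segment from `ι x` to `r_K(ι x)` stays in `A`
    have hseg : ∀ (x : X) (hx : x ∈ V) (t : ℝ), 0 ≤ t → t ≤ 1 →
        (1 - t) • ι x + t • (rK ⟨ι x, hVOK hx⟩ : Fin m → ℝ) ∈ A := by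
      intro x hx t ht0 ht1
      obtain ⟨q, hq, hxq⟩ := mem_iUnion₂.1 hx
      have hxq' : dist (ι x) q < δ q := mem_ball.1 hxq
      have h1 : ι x ∈ ball q (ε q) := mem_ball.2 (lt_of_lt_of_le hxq' (hδε q hq))
      have h2 : (rK ⟨ι x, hVOK hx⟩ : Fin m → ℝ) ∈ ball q (ε q) :=
        mem_ball.2 (hcont q hq (ι x) (hVOK hx) hxq')
      exact (hball q hq ((convex_ball q (ε q)) h1 h2 (by linarith) ht0 (by ring))).1
    have hVU : V ⊆ U := fun x hx => by
      have h := hAU _ (hseg x hx 0 le_rfl zero_le_one)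
      have h0 : (⟨(1 - (0 : ℝ)) • ι x + (0 : ℝ) • (rK ⟨ι x, hVOK hx⟩ : Fin m → ℝ),
          hAOX (hseg x hx 0 le_rfl zero_le_one)⟩ : OX) = ⟨ι x, hXO (mem_range_self x)⟩ :=
        Subtype.ext (by simp)
      rwa [h0, hρ (ι x) (mem_range_self x), hesymm] at h
    -- the homotopy
    let sE : I × V → Fin m → ℝ := fun z =>
      (1 - (z.1 : ℝ)) • ι z.2.1 + (z.1 : ℝ) • (rK ⟨ι z.2.1, hVOK z.2.2⟩ : Fin m → ℝ)
    have hsE : Continuous sE := by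
      have h1 : Continuous fun z : I × V => ((z.1 : ℝ)) :=
        continuous_subtype_val.comp continuous_fst
      have h2 : Continuous fun z : I × V => ι z.2.1 :=
        hι.continuous.comp (continuous_subtype_val.comp continuous_snd)
      have h3 : Continuous fun z : I × V => (rK ⟨ι z.2.1, hVOK z.2.2⟩ : Fin m → ℝ) :=
        continuous_subtype_val.comp (rK.continuous.comp (h2.subtype_mk _))
      exact ((continuous_const.sub h1).smul h2).add (h1.smul h3)
    have hsA : ∀ z, sE z ∈ A := fun z => hseg z.2.1 z.2.2 z.1 z.1.2.1 z.1.2.2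
    let G : I × V → X := fun z => e.symm (ρ ⟨sE z, hAOX (hsA z)⟩)
    have hG : Continuous G := e.symm.continuous.comp (ρ.continuous.comp (hsE.subtype_mk _))
    have hGU : ∀ z, G z ∈ U := fun z => hAU _ (hsA z)
    refine ⟨V, hVo, hKV, hVU, ⟨⟨⟨fun z => ⟨G z, hGU z⟩, hG.subtype_mk _⟩, fun x => ?_,
      fun x => ?_⟩⟩⟩
    · ext
      change e.symm (ρ ⟨sE (0, x), _⟩) = x
      have h0 : (⟨sE (0, x), hAOX (hsA (0, x))⟩ : OX) = ⟨ι x, hXO (mem_range_self _)⟩ :=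
        Subtype.ext (by simp [sE])
      rw [h0, hρ (ι x) (mem_range_self _), hesymm]
    · ext
      change e.symm (ρ ⟨sE (1, x), _⟩) = (r ⟨x, _⟩ : X)
      have h1 : (⟨sE (1, x), hAOX (hsA (1, x))⟩ : OX) =
          ⟨(rK ⟨ι x, hVOK x.2⟩ : Fin m → ℝ), hXO (hrK_range _)⟩ :=
        Subtype.ext (by simp [sE])
      rw [h1, hρ _ (hrK_range _), hr]

/-- **A compact locally contractible subset of a Euclidean neighbourhood retract is taut**
(Spanier 1966, Ch. 6 §1, Cor. 11 with Hatcher 2002, Thm. A.7): if `X` embeds in `ℝᵐ` with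
image a neighbourhood retract, every compact `K ⊆ X` with `↥K` locally contractible (e.g. a
compact topological manifold, with or without boundary) carries a tautness datum — by the
tree's PROVED Euclidean-neighbourhood-retract theorem
`isNeighbourhoodRetract_of_isCompact_of_locallyContractibleSpace` applied to `ι(K)`.
[cite: Spanier1981, Ch. 6 §1, Cor. 11] -/
theorem nonempty_of_locallyContractibleSpace (hι : IsEmbedding ι)
    (hX : IsNeighbourhoodRetract (range ι)) (hKc : IsCompact K)
    (hKl : LocallyContractibleSpace K) : Nonempty (RetractionNhds K) :=
  nonempty_of_isNeighbourhoodRetract hι hX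
    (isNeighbourhoodRetract_of_isCompact_of_locallyContractibleSpace (hKc.image hι.continuous)
      (locallyContractibleSpace_of_homeomorph (hι.homeomorphImage K) hKl))

end RetractionNhds

/-- **Tautness of compact locally contractible subsets of Euclidean neighbourhood retracts**
(Spanier 1966, Ch. 6 §1, Thm. 10 and Cor. 11; Miller 2020, p. 121): for `X` embedded in `ℝᵐ`
with image a neighbourhood retract and `K ⊆ X` compact with `↥K` locally contractible, the
natural map `Ȟ^p(K; N) → H^p_X(K; N)` is bijective, for every coefficient object `N`.
[cite: Spanier1981, Ch. 6 §1, Thm. 10] -/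
theorem bijective_toSubset_of_locallyContractibleSpace {K : Set X} {m : ℕ} {ι : X → (Fin m → ℝ)}
    (hι : IsEmbedding ι) (hX : Literature.AlgebraicTopology.Homotopy.IsNeighbourhoodRetract (range ι))
    (hKc : IsCompact K) (hKl : LocallyContractibleSpace K) (p : ℕ) :
    Function.Bijective (toSubset R N K p) :=
  (RetractionNhds.nonempty_of_locallyContractibleSpace hι hX hKc hKl).some.bijective_toSubset p

/-- **`Ȟ^p(K; ULift R) ≃ H^p(↥K; R)`** for `K` compact with `↥K` locally contractible inside
an `X` embedded in `ℝᵐ` as a neighbourhood retract (Spanier 1966, Ch. 6 §1, Thm. 10, Cor. 11).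
[cite: Spanier1981, Ch. 6 §1, Thm. 10] -/
def cechEquivOfLocallyContractibleSpace {K : Set X} {m : ℕ} {ι : X → (Fin m → ℝ)}
    (hι : IsEmbedding ι) (hX : Literature.AlgebraicTopology.Homotopy.IsNeighbourhoodRetract (range ι))
    (hKc : IsCompact K) (hKl : LocallyContractibleSpace K) (p : ℕ) :
    Cech R (ModuleCat.of R (ULift.{u} R)) K p ≃ₗ[R] singularCohomology R R (↥K) p :=
  (RetractionNhds.nonempty_of_locallyContractibleSpace hι hX hKc hKl).some.cechEquiv R p

end Cech

end Literature.AlgebraicTopology.SingularHomology
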